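import Summits.AtomisticToContinuum.HydrodynamicLimit.Theorems.ImplosionDichotomyPolynomialCompressionIsentropicCalculus

/-!
# Reference envelope and the final `(M, η)`-bounds (closing of stub 4, part 4)

Helper file for the line `log-lipschitz-budget` of the crux `ImplosionDichotomy.PolynomialCompression`
(stmt-AtomisticToContinuum-12587), stub `stub_logBudgetShadowing`, blueprint §5 (the CLOSE). Two
pieces of bookkeeping around the isentropic Type-I reference `(ρ₁, u₁, θ₁)`:

* `lbClose_reference_envelope` — from the no-vacuum floor `cl (T₁ - t)^{pl} ≤ ρ₁` and the order-zero
  polynomial bounds `|ρ₁|, ‖u₁‖ ≤ C₀ (T₁ - t)^{-p₀}` one gets constants `0 < r ≤ 1 ≤ R`, `pl', pu' ≥ 0`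
  with `r ≤ ρ₁^{1/3} X^{pl'}`, `ρ₁^{1/3}, ρ₁, ‖u₁‖ ≤ R X^{pu'}`, `X = T₁/(T₁ - t) ≥ 1`;
* `lbClose_final_bounds` — at a point where the weak bootstrap bounds hold (relative closeness of
  `ρ, θ`, packing, the three weighted gradient bounds, `‖δu‖ ≤ 1`) and the reference is enveloped by
  `L ≤ ρ₁^{1/3} ≤ U`, `‖u₁‖ ≤ U`, `1/(T₁ - t) ≤ X_b/T₁`, the state and the first derivatives of the
  σ-solution obey the `(M, η)`-bounds of `stub_conditionalExistence` with an explicit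
  `M = M(K, C, T₁, L, U, X_b)`, and `ρ₁ ≤ 2ρ`.
-/

noncomputable section

namespace Summit.AtomisticToContinuum.HydrodynamicLimit.Theorems

open Set MeasureTheory
open Literature.MathematicalPhysics.KineticTheory Literature.Analysis.FunctionSpaces

/-! ### The envelope of the reference -/

/-- `(T₁ - t)^p = T₁^p · X^{-p}` for `X = T₁/(T₁ - t)`, `0 < T₁ - t`, `0 < T₁`. [folklore] -/
theorem lbClose_rpow_lapse {T₁ t p : ℝ} (hT₁ : 0 < T₁) (hl : 0 < T₁ - t) :
    (T₁ - t) ^ p = T₁ ^ p * (T₁ / (T₁ - t)) ^ (-p) := by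
  rw [Real.rpow_neg (div_pos hT₁ hl).le, Real.div_rpow hT₁.le hl.le]
  field_simp

/-- **Envelope of the reference.** See the module docstring. [folklore] -/
theorem lbClose_reference_envelope :
    ∀ (T₁ cl pl C₀ p₀ : ℝ), 0 < T₁ → 0 < cl →
      ∃ r R pl' pu' : ℝ, 0 < r ∧ r ≤ 1 ∧ 1 ≤ R ∧ 0 ≤ pl' ∧ 0 ≤ pu' ∧
        ∀ {T : ℝ} {ρ₁ : ℝ → T3 → ℝ} {u₁ : ℝ → T3 → V3}, T ≤ T₁ →
          (∀ t ∈ Ico 0 T, ∀ x, 0 < ρ₁ t x) →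
          (∀ t ∈ Ico 0 T, ∀ x, cl * (T₁ - t) ^ pl ≤ ρ₁ t x) →
          (∀ t ∈ Ico 0 T, ∀ y : EuclideanSpace ℝ (Fin 3),
            ‖iteratedFDeriv ℝ 0 (Torus.lift (ρ₁ t)) y‖ ≤ C₀ * (T₁ - t) ^ (-p₀) ∧
            ‖iteratedFDeriv ℝ 0 (Torus.lift (u₁ t)) y‖ ≤ C₀ * (T₁ - t) ^ (-p₀)) →
          ∀ t ∈ Ico 0 T, ∀ x, r ≤ ρ₁ t x ^ (1 / 3 : ℝ) * (T₁ / (T₁ - t)) ^ pl' ∧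
            ρ₁ t x ^ (1 / 3 : ℝ) ≤ R * (T₁ / (T₁ - t)) ^ pu' ∧ ρ₁ t x ≤ R * (T₁ / (T₁ - t)) ^ pu' ∧
            ‖u₁ t x‖ ≤ R * (T₁ / (T₁ - t)) ^ pu' := by
  intro T₁ cl pl C₀ p₀ hT₁ hcl
  set r : ℝ := min (cl * T₁ ^ pl) 1 with hr_def
  set R : ℝ := max (C₀ * T₁ ^ (-p₀)) 0 + 1 with hR_def
  have hr0 : 0 < r := lt_min (mul_pos hcl (Real.rpow_pos_of_pos hT₁ pl)) one_pos
  have hr1 : r ≤ 1 := min_le_right _ _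
  have hR1 : 1 ≤ R := by
    have : 0 ≤ max (C₀ * T₁ ^ (-p₀)) 0 := le_max_right _ _
    linarith
  refine ⟨r, R, |pl|, |p₀|, hr0, hr1, hR1, abs_nonneg _, abs_nonneg _, ?_⟩
  intro T ρ₁ u₁ hT hpos hfloor hpoly t ht x
  have hl : 0 < T₁ - t := by linarith [ht.2]
  set X : ℝ := T₁ / (T₁ - t) with hX_def
  have hX1 : 1 ≤ X := by rw [hX_def, le_div_iff₀ hl]; linarith [ht.1]
  have hX0 : 0 < X := one_pos.trans_le hX1
  have hρ0 := hpos t ht x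
  set c : ℝ := ρ₁ t x ^ (1 / 3 : ℝ) with hc_def
  have hc0 : 0 < c := Real.rpow_pos_of_pos hρ0 _
  have hc3 : c ^ 3 = ρ₁ t x := by
    rw [hc_def, ← Real.rpow_natCast, ← Real.rpow_mul hρ0.le]; norm_num
  -- upper bounds from the order-zero polynomial bound
  obtain ⟨y, hy⟩ := Torus.proj_surjective x
  have hup : ∀ v : ℝ, v ≤ C₀ * (T₁ - t) ^ (-p₀) → v ≤ R * X ^ |p₀| := by
    intro v hv
    have h1 : (T₁ - t) ^ (-p₀) = T₁ ^ (-p₀) * X ^ p₀ := by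
      have := lbClose_rpow_lapse (p := -p₀) hT₁ hl
      rw [neg_neg] at this
      exact this
    have h2 : X ^ p₀ ≤ X ^ |p₀| := Real.rpow_le_rpow_of_exponent_le hX1 (le_abs_self _)
    have h3 : C₀ * T₁ ^ (-p₀) ≤ max (C₀ * T₁ ^ (-p₀)) 0 := le_max_left _ _
    have h4 : 0 ≤ max (C₀ * T₁ ^ (-p₀)) 0 := le_max_right _ _
    have hXp : 0 ≤ X ^ p₀ := Real.rpow_nonneg hX0.le _
    calc v ≤ C₀ * T₁ ^ (-p₀) * X ^ p₀ := by rw [h1, ← mul_assoc] at hv; exact hv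
      _ ≤ max (C₀ * T₁ ^ (-p₀)) 0 * X ^ |p₀| :=
          (mul_le_mul_of_nonneg_right h3 hXp).trans (mul_le_mul_of_nonneg_left h2 h4)
      _ ≤ R * X ^ |p₀| := mul_le_mul_of_nonneg_right (by linarith) (Real.rpow_nonneg hX0.le _)
  have hρup : ρ₁ t x ≤ R * X ^ |p₀| := by
    refine hup _ ((le_abs_self _).trans ?_)
    have h := (hpoly t ht y).1
    rwa [norm_iteratedFDeriv_zero, Torus.lift_apply, hy, Real.norm_eq_abs] at h
  have huup : ‖u₁ t x‖ ≤ R * X ^ |p₀| := by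
    refine hup _ ?_
    have h := (hpoly t ht y).2
    rwa [norm_iteratedFDeriv_zero, Torus.lift_apply, hy] at h
  have hRX : 1 ≤ R * X ^ |p₀| := one_le_mul_of_one_le_of_one_le hR1 (Real.one_le_rpow hX1 (abs_nonneg _))
  have hcup : c ≤ R * X ^ |p₀| := by
    rcases le_or_gt (ρ₁ t x) 1 with h | h
    · exact (Real.rpow_le_one hρ0.le h (by norm_num)).trans hRX
    · calc c ≤ ρ₁ t x ^ (1 : ℝ) := Real.rpow_le_rpow_of_exponent_le h.le (by norm_num)
        _ = ρ₁ t x := Real.rpow_one _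
        _ ≤ R * X ^ |p₀| := hρup
  -- lower bound from the floor
  have hlow : r ≤ c * X ^ |pl| := by
    have hXl : 0 < X ^ |pl| := Real.rpow_pos_of_pos hX0 _
    set ℓ : ℝ := r / X ^ |pl| with hℓ_def
    have hℓ0 : 0 < ℓ := div_pos hr0 hXl
    have hℓ1 : ℓ ≤ 1 := by
      rw [hℓ_def, div_le_one hXl]
      exact hr1.trans (Real.one_le_rpow hX1 (abs_nonneg _))
    -- `ℓ ≤ ρ₁`
    have hfl := hfloor t ht x
    have h1 : (T₁ - t) ^ pl = T₁ ^ pl * X ^ (-pl) := lbClose_rpow_lapse hT₁ hl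
    have h2 : X ^ (-|pl|) ≤ X ^ (-pl) :=
      Real.rpow_le_rpow_of_exponent_le hX1 (neg_le_neg (le_abs_self _))
    have hℓρ : ℓ ≤ ρ₁ t x := by
      calc ℓ = r * X ^ (-|pl|) := by rw [hℓ_def, Real.rpow_neg hX0.le, div_eq_mul_inv]
        _ ≤ cl * T₁ ^ pl * X ^ (-|pl|) :=
            mul_le_mul_of_nonneg_right (min_le_left _ _) (Real.rpow_nonneg hX0.le _)
        _ ≤ cl * T₁ ^ pl * X ^ (-pl) := mul_le_mul_of_nonneg_left h2 (by positivity)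
        _ = cl * (T₁ - t) ^ pl := by rw [h1, mul_assoc]
        _ ≤ ρ₁ t x := hfl
    -- `ℓ ≤ ℓ^{1/3} ≤ ρ₁^{1/3} = c`
    have hℓc : ℓ ≤ c := by
      calc ℓ = ℓ ^ (1 : ℝ) := (Real.rpow_one ℓ).symm
        _ ≤ ℓ ^ (1 / 3 : ℝ) := Real.rpow_le_rpow_of_exponent_ge hℓ0 hℓ1 (by norm_num)
        _ ≤ c := Real.rpow_le_rpow hℓ0.le hℓρ (by norm_num)
    rwa [hℓ_def, div_le_iff₀ hXl] at hℓc
  exact ⟨hlow, hcup, hρup, huup⟩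

/-! ### The final `(M, η)`-bounds -/

/-- `|a| ≤ |b| + |a - b|`. [folklore] -/
theorem lbClose_abs_le_insert (a b : ℝ) : |a| ≤ |b| + |a - b| := by
  have h := abs_add_le b (a - b)
  rwa [add_sub_cancel] at h

/-- **The `(M, η)`-bounds of the σ-solution from the weak bootstrap bounds.** See the module docstring:
`M = 2/L³ + 2U³ + 2/(KL²) + 2KU² + (U + 1) + (C + 1)X_b/T₁ + U²X_b(3C + 1/√K)/T₁ + UX_b(2KC + √K)/T₁ + 1`.
[folklore] -/
theorem lbClose_final_bounds :
    ∀ (K C T₁ L U Xb η : ℝ), 0 < K → 0 ≤ C → 0 < T₁ → 0 < L → 0 < U → 0 < Xb →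
      ∃ M : ℝ, 0 < M ∧ ∀ {σ T ηs : ℝ} {ρ θ ρ₁ θ₁ : ℝ → T3 → ℝ} {u u₁ : ℝ → T3 → V3} {t : ℝ} {x : T3},
        IsHardSphereEulerSolution 0 T ρ₁ u₁ θ₁ → t ∈ Ico 0 T → 0 < T₁ - t → 1 / (T₁ - t) ≤ Xb / T₁ →
        (∀ t ∈ Ico 0 T, ∀ x, θ₁ t x = K * ρ₁ t x ^ (2 / 3 : ℝ)) →
        L ≤ ρ₁ t x ^ (1 / 3 : ℝ) → ρ₁ t x ^ (1 / 3 : ℝ) ≤ U → ‖u₁ t x‖ ≤ U →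
        (∀ i : Fin 3, ‖Torus.partialDeriv i (u₁ t) x‖ ≤ C / (T₁ - t) ∧
          |Torus.partialDeriv i (fun y => ρ₁ t y ^ (1 / 3 : ℝ)) x| ≤ C / (T₁ - t)) →
        |ρ t x - ρ₁ t x| ≤ ρ₁ t x / 2 → |θ t x - θ₁ t x| ≤ θ₁ t x / 2 → ρ t x * σ ^ 3 ≤ ηs → ηs ≤ η →
        ‖u t x - u₁ t x‖ ≤ 1 →
        (∀ i : Fin 3, ‖Torus.partialDeriv i (u t) x - Torus.partialDeriv i (u₁ t) x‖ ≤ 1 / (T₁ - t) ∧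
          Real.sqrt (θ₁ t x) * |Torus.partialDeriv i (ρ t) x - Torus.partialDeriv i (ρ₁ t) x| /
              ρ₁ t x ≤ 1 / (T₁ - t) ∧
          |Torus.partialDeriv i (θ t) x - Torus.partialDeriv i (θ₁ t) x| / Real.sqrt (θ₁ t x) ≤
            1 / (T₁ - t)) →
        (M⁻¹ ≤ ρ t x ∧ ρ t x ≤ M ∧ M⁻¹ ≤ θ t x ∧ θ t x ≤ M ∧ ‖u t x‖ ≤ M ∧ ρ t x * σ ^ 3 ≤ η ∧
          ∀ i : Fin 3, ‖Torus.partialDeriv i (u t) x‖ ≤ M ∧ |Torus.partialDeriv i (ρ t) x| ≤ M ∧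
            |Torus.partialDeriv i (θ t) x| ≤ M) ∧
        ρ₁ t x ≤ 2 * ρ t x := by
  intro K C T₁ L U Xb η hK hC hT₁ hL hU hXb
  have hsK : 0 < Real.sqrt K := Real.sqrt_pos.2 hK
  set M : ℝ := 2 / L ^ 3 + 2 * U ^ 3 + 2 / (K * L ^ 2) + 2 * K * U ^ 2 + (U + 1) + (C + 1) * Xb / T₁ +
    U ^ 2 * Xb * (3 * C + 1 / Real.sqrt K) / T₁ + U * Xb * (2 * K * C + Real.sqrt K) / T₁ + 1 with hM
  have m1 : 0 < 2 / L ^ 3 := by positivity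
  have m2 : 0 ≤ 2 * U ^ 3 := by positivity
  have m3 : 0 < 2 / (K * L ^ 2) := by positivity
  have m4 : 0 ≤ 2 * K * U ^ 2 := by positivity
  have m5 : 0 ≤ U + 1 := by positivity
  have m6 : 0 ≤ (C + 1) * Xb / T₁ := by positivity
  have m7 : 0 ≤ U ^ 2 * Xb * (3 * C + 1 / Real.sqrt K) / T₁ := by positivity
  have m8 : 0 ≤ U * Xb * (2 * K * C + Real.sqrt K) / T₁ := by positivity
  have hM0 : 0 < M := by positivity
  refine ⟨M, hM0, ?_⟩
  intro σ T ηs ρ θ ρ₁ θ₁ u u₁ t x hE₁ ht hl hXl hisen hLc hcU hu₁ hTI hδρ hδθ hpack hηs hδu hgrad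
  have hρ₁0 : 0 < ρ₁ t x := hE₁.density_pos t ht x
  obtain ⟨hc, hρ₁c, hθ₁c, hsq⟩ := isentropic_pointwise_algebra hK hρ₁0 (hisen t ht x)
  set c : ℝ := ρ₁ t x ^ (1 / 3 : ℝ) with hc_def
  have hc2U : c ^ 2 ≤ U ^ 2 := pow_le_pow_left₀ hc.le hcU 2
  have hc3U : c ^ 3 ≤ U ^ 3 := pow_le_pow_left₀ hc.le hcU 3
  have hLc2 : L ^ 2 ≤ c ^ 2 := pow_le_pow_left₀ hL.le hLc 2
  have hLc3 : L ^ 3 ≤ c ^ 3 := pow_le_pow_left₀ hL.le hLc 3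
  have hθ₁0 : 0 < θ₁ t x := by rw [hθ₁c]; positivity
  have hsθ : 0 < Real.sqrt (θ₁ t x) := Real.sqrt_pos.2 hθ₁0
  have hρ1 : ρ₁ t x / 2 ≤ ρ t x := by linarith [(abs_le.1 hδρ).1]
  have hρ2 : ρ t x ≤ 3 / 2 * ρ₁ t x := by linarith [(abs_le.1 hδρ).2]
  have hθ1 : θ₁ t x / 2 ≤ θ t x := by linarith [(abs_le.1 hδθ).1]
  have hθ2 : θ t x ≤ 3 / 2 * θ₁ t x := by linarith [(abs_le.1 hδθ).2]
  have hinv : 1 / (T₁ - t) ≤ Xb / T₁ := hXl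
  have hCl : C / (T₁ - t) ≤ C * Xb / T₁ := by
    calc C / (T₁ - t) = C * (1 / (T₁ - t)) := by ring
      _ ≤ C * (Xb / T₁) := mul_le_mul_of_nonneg_left hinv hC
      _ = C * Xb / T₁ := by ring
  refine ⟨⟨?_, ?_, ?_, ?_, ?_, hpack.trans hηs, fun i => ⟨?_, ?_, ?_⟩⟩, by linarith⟩
  · -- `M⁻¹ ≤ L³/2 ≤ ρ`
    have h1 : M⁻¹ ≤ (2 / L ^ 3)⁻¹ := inv_anti₀ m1 (by linarith)
    rw [inv_div] at h1
    have h2 : L ^ 3 / 2 ≤ ρ t x := by rw [hρ₁c] at hρ1; linarith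
    exact h1.trans h2
  · have h3 : 0 ≤ U ^ 3 := by positivity
    have : ρ t x ≤ 2 * U ^ 3 := by rw [hρ₁c] at hρ2; linarith
    linarith
  · have h1 : M⁻¹ ≤ (2 / (K * L ^ 2))⁻¹ := inv_anti₀ m3 (by linarith)
    rw [inv_div] at h1
    have h2 : K * L ^ 2 / 2 ≤ θ t x := by
      have := mul_le_mul_of_nonneg_left hLc2 hK.le
      rw [hθ₁c] at hθ1; linarith
    exact h1.trans h2
  · have : θ t x ≤ 2 * K * U ^ 2 := by
      have := mul_le_mul_of_nonneg_left hc2U hK.le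
      have h3 : 0 ≤ K * U ^ 2 := by positivity
      rw [hθ₁c] at hθ2; linarith
    linarith
  · have : ‖u t x‖ ≤ U + 1 :=
      (norm_le_insert' (u t x) (u₁ t x)).trans (add_le_add hu₁ hδu)
    linarith
  · -- `‖∂ᵢu‖ ≤ C/(T₁-t) + 1/(T₁-t) ≤ (C+1) Xb/T₁`
    have h1 := (norm_le_insert' (Torus.partialDeriv i (u t) x) (Torus.partialDeriv i (u₁ t) x)).trans
      (add_le_add (hTI i).1 (hgrad i).1)
    have h2 : (C + 1) * Xb / T₁ = C * Xb / T₁ + Xb / T₁ := by ring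
    linarith
  · -- `|∂ᵢρ| ≤ 3c² C/(T₁-t) + c²/(√K (T₁-t))`
    obtain ⟨hdρ₁, -⟩ := isentropic_typeI_transfer hE₁ hK hisen ht x i (hTI i).2
    have hd : |Torus.partialDeriv i (ρ t) x - Torus.partialDeriv i (ρ₁ t) x| ≤
        c ^ 2 / Real.sqrt K * (1 / (T₁ - t)) := by
      have h := (hgrad i).2.1
      rw [hsq, hρ₁c, div_le_iff₀ (by positivity)] at h
      calc |Torus.partialDeriv i (ρ t) x - Torus.partialDeriv i (ρ₁ t) x|
          = Real.sqrt K * c * |Torus.partialDeriv i (ρ t) x - Torus.partialDeriv i (ρ₁ t) x| /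
              (Real.sqrt K * c) := by field_simp
        _ ≤ 1 / (T₁ - t) * c ^ 3 / (Real.sqrt K * c) := div_le_div_of_nonneg_right h (by positivity)
        _ = c ^ 2 / Real.sqrt K * (1 / (T₁ - t)) := by field_simp
    have e1 : 3 * (ρ₁ t x ^ (1 / 3 : ℝ)) ^ 2 * (C / (T₁ - t)) ≤ 3 * U ^ 2 * (C * Xb / T₁) :=
      mul_le_mul (mul_le_mul_of_nonneg_left hc2U (by norm_num)) hCl (by positivity) (by positivity)
    have e2 : c ^ 2 / Real.sqrt K * (1 / (T₁ - t)) ≤ U ^ 2 / Real.sqrt K * (Xb / T₁) :=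
      mul_le_mul (div_le_div_of_nonneg_right hc2U hsK.le) hinv (by positivity) (by positivity)
    have e3 : 3 * U ^ 2 * (C * Xb / T₁) + U ^ 2 / Real.sqrt K * (Xb / T₁) =
        U ^ 2 * Xb * (3 * C + 1 / Real.sqrt K) / T₁ := by
      field_simp
    have e4 := lbClose_abs_le_insert (Torus.partialDeriv i (ρ t) x) (Torus.partialDeriv i (ρ₁ t) x)
    linarith
  · -- `|∂ᵢθ| ≤ 2Kc C/(T₁-t) + √K c/(T₁-t)`
    obtain ⟨-, hdθ₁⟩ := isentropic_typeI_transfer hE₁ hK hisen ht x i (hTI i).2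
    have hd : |Torus.partialDeriv i (θ t) x - Torus.partialDeriv i (θ₁ t) x| ≤
        1 / (T₁ - t) * (Real.sqrt K * c) := by
      have h := (hgrad i).2.2
      rwa [hsq, div_le_iff₀ (by positivity)] at h
    have e1 : 2 * K * ρ₁ t x ^ (1 / 3 : ℝ) * (C / (T₁ - t)) ≤ 2 * K * U * (C * Xb / T₁) :=
      mul_le_mul (mul_le_mul_of_nonneg_left hcU (by positivity)) hCl (by positivity) (by positivity)
    have e2 : 1 / (T₁ - t) * (Real.sqrt K * c) ≤ Xb / T₁ * (Real.sqrt K * U) :=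
      mul_le_mul hinv (mul_le_mul_of_nonneg_left hcU hsK.le) (by positivity) (by positivity)
    have e3 : 2 * K * U * (C * Xb / T₁) + Xb / T₁ * (Real.sqrt K * U) =
        U * Xb * (2 * K * C + Real.sqrt K) / T₁ := by
      field_simp
    have e4 := lbClose_abs_le_insert (Torus.partialDeriv i (θ t) x) (Torus.partialDeriv i (θ₁ t) x)
    linarith

end Summit.AtomisticToContinuum.HydrodynamicLimit.Theorems

end
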